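import Summits.ValiantsHypothesis.ValiantsHypothesis.Theorems.BarrierLeverNPCorpusChainBDGIL
import Literature.Barriers.ValiantsHypothesis.BDGIL24NaturalProofsMainTheoremProofs

/-!
# Route BarrierLever — the NP corpus chain, part 3b made unconditional: the BDGIL leg no longer
# assumes [BergEtAl2024] Thm. 2.4

Part 3b (`BarrierLeverNPCorpusChainBDGIL.lean`) proved, for the crux
`Theses.BarrierLever.SuccinctHittingSetsForVP` (stmt-ValiantsHypothesis-14610 = FSV Question 6 over
`ℂ`), the arrows `exists_isotypic_equations_of_not_crux` and `crux_of_no_isotypic_equations` under the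
hypothesis `(h24 : BergEtAl2024.thm_2_4)` — the main theorem of van den Berg–Dutta–Gesmundo–
Ikenmeyer–Lysikov 2024 (arXiv:2411.03444, Thm. 2.4) as a named fact. That fact is now a THEOREM of
the tree, `Literature.Barriers.ValiantsHypothesis.BergEtAl2024.thm_2_4_holds`
(`BDGIL24NaturalProofsMainTheoremProofs.lean`, val-lit t22), so both arrows hold outright:

* `exists_isotypic_equations_of_not_crux'` — if the crux FAILS, there is a not-eventually-zero
  sequence of ISOTYPIC metapolynomials (each `Δ_n` in one `GL_{k(n)}`-isotypic component) in
  `I(C_VP) ∩ metaVQP`, for the class `VP` cut out by the invariant measure `cc = affComplexity`;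
* `crux_of_no_isotypic_equations'` — contrapositive: **no isotypic quasi-polynomial equation
  sequence against the `cc`-slices of `VP` ⟹ `SuccinctHittingSetsForVP`.**

Honest framing. This is a SUFFICIENT condition for the crux, NOT an equivalence (Def. 2.3 allows
quasi-polynomial distinguishers, free formats and asks vanishing only eventually; cf. part 2's
a.e./i.o. gap); the hypothesis "no isotypic equations" is open, the rung `SuccinctHittingSetsForVP`
stays OPEN, and `VP ≠ VNP` is not touched. No `sorry`, no named-fact hypotheses, no definitions.

References: [BergEtAl2024] Def. 2.3, Thm. 2.4 (arXiv:2411.03444, p.10–12);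
[ForbesShpilkaVolk2018] Question 6.
-/

set_option linter.dupNamespace false

noncomputable section

namespace Summit.ValiantsHypothesis.ValiantsHypothesis.Theorems.BarrierLever.NPCorpusChainBDGIL

open MvPolynomial Literature.Barriers.ValiantsHypothesis Literature.Computability.AlgebraicComplexity
open Literature.Barriers.ValiantsHypothesis.BergEtAl2024

/-- **¬ crux ⟹ ISOTYPIC equations (unconditional).** If `SuccinctHittingSetsForVP` fails, there is
a not-eventually-zero sequence of isotypic metapolynomials in `I(C_VP) ∩ metaVQP` for the invariant
measure `cc = affComplexity` — part 3b's `exists_isotypic_equations_of_not_crux` with its Thm. 2.4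
hypothesis discharged by `BergEtAl2024.thm_2_4_holds`.
[cite: BergEtAl2024, Thm. 2.4, p.11; ForbesShpilkaVolk2018, Question 6] -/
theorem exists_isotypic_equations_of_not_crux'
    (h : ¬ Theses.BarrierLever.SuccinctHittingSetsForVP) :
    ∃ (kk : ℕ → ℕ) (Δ : (n : ℕ) → MvPolynomial (DegIdx (Fin (kk n)) n) ℂ),
      Δ ∈ vanishingIdealSeq (fun _ _ f => affComplexity f) kk ∧ Δ ∈ metaVQP kk ∧
        (∀ n, IsIsotypic (Δ n)) ∧ ¬ EventuallyZero Δ :=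
  exists_isotypic_equations_of_not_crux thm_2_4_holds h

/-- **What would suffice, in the V3 language (unconditional): NO isotypic quasi-polynomial equation
sequence against the `cc`-slices of `VP` ⟹ the crux `SuccinctHittingSetsForVP`** (FSV Question 6
over `ℂ`, stmt-ValiantsHypothesis-14610) — part 3b's `crux_of_no_isotypic_equations` with its
Thm. 2.4 hypothesis discharged by `BergEtAl2024.thm_2_4_holds`. Honest framing: a sufficient
condition, not an equivalence; the hypothesis is open and the rung stays open.
[cite: BergEtAl2024, Thm. 2.4, p.11; ForbesShpilkaVolk2018, Question 6] -/
theorem crux_of_no_isotypic_equations'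
    (hno : ¬ ∃ (kk : ℕ → ℕ) (Δ : (n : ℕ) → MvPolynomial (DegIdx (Fin (kk n)) n) ℂ),
      Δ ∈ vanishingIdealSeq (fun _ _ f => affComplexity f) kk ∧ Δ ∈ metaVQP kk ∧
        (∀ n, IsIsotypic (Δ n)) ∧ ¬ EventuallyZero Δ) :
    Theses.BarrierLever.SuccinctHittingSetsForVP :=
  crux_of_no_isotypic_equations thm_2_4_holds hno

end Summit.ValiantsHypothesis.ValiantsHypothesis.Theorems.BarrierLever.NPCorpusChainBDGIL

end
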